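import Summits.AnomalousDissipation.AnomalousDissipation.Theorems.StirringSphereEnsembleRealizationStubAugCurrentLevelEntry
import Summits.AnomalousDissipation.AnomalousDissipation.Theorems.StirringSphereEnsembleRealizationStubAugCurrentLevelMarg

/-!
# Crux `EnsembleRealization` (stmt-AnomalousDissipation-0215) — line `augmented-lift`,
# sub-stub (M1a) `stub_augCurrentLevelPairs`, piece (L3): the augmented current of one level

Supports stmt-AnomalousDissipation-0215 (stub `stub_augCurrentLevelPairs` of line
`augmented-lift`, piece L3 `stub_augCurrentLevelCurrentTools`, step (A3) of
`augCurrent-notes.md` §3). Nothing here closes an item. Theorems only.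

One level of the construction: smooth solenoidal mean-zero fields `g₀, …, g_{D-1}` with Bessel
coordinates `ξ(u) = ((u, gⱼ))ⱼ`, the a.e. ball `‖u‖ ≤ R` of the Foias–Prodi law `μ`, the
cylindrical energy inequalities `CEI(ν, f, μ)` and a width `δ > 0`. With the one-sided product
mollifier `ρ = ρ₁ ⊗ ρ₂` and the energy primitive `P₂` of `stub_augCurrentProfileTools` and the
coordinate map `Z u = (ξ(u), ‖u‖²)`, the CURRENT is
`J_w,j(z) = ∫ ρ(z − Z u) ⟨F(u), gⱼ⟩ dμ`, `J_e(z) = −Σⱼ ∫ (∂ⱼρ₁ ⊗ P₂)(z − Z u) ⟨F(u), gⱼ⟩ dμ`, and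
the mollified law is `p₁(z) = ∫ ρ(z − Z u) dμ`. We prove: `C¹` regularity
(`stub_augCurrentKernelTools`), support in the box `closedBall 0 (R + δ) ×ˢ [0, R² + δ]` (ball
bound; above the energy range by `CEI(ψ_z)` and `CEI(+ρ₁(w − ·))`), vanishing classical
divergence (`∂_e (∂ⱼρ₁ ⊗ P₂) = ∂ⱼρ₁ ⊗ ρ₂ = ∂ⱼ(ρ₁ ⊗ ρ₂)`), unit mass of `p₁` (Tonelli), the CEI
inequality `J_e + 2 ∫ ρ(· − Z u)(ν‖u‖_V² − (u, f)) dμ ≤ 0` (`CEI(ψ_z)`,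
`ψ_z = −ρ₁(w − ·) P₂(e − ·)`) and the rate bound `‖𝓕(Σⱼ J_w,j gⱼ)(k)‖ ≤ L k · p₁`. Packaged as
`stub_augCurrentLevelCurrentTools`.
-/

noncomputable section

set_option linter.dupNamespace false

open MeasureTheory Set Filter Topology Function Metric UnitAddTorus
open scoped BigOperators ENNReal InnerProductSpace RealInnerProductSpace

namespace Summit.AnomalousDissipation.AnomalousDissipation.Theorems.EnsembleRealization

open Literature.Analysis.FunctionSpaces Literature.Analysis.FunctionSpaces.Torus
open Literature.Analysis.FluidPDE Literature.Analysis.FluidPDE.Torus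

/-- **Current tools for (M1a), piece (L3).** See the module docstring. -/
theorem stub_augCurrentLevelCurrentTools {ν : ℝ} {f : UnitAddTorus (Fin 3) → EuclideanSpace ℝ (Fin 3)}
    {μ : Measure (Torus.energySpace (Fin 3))} (hf : IsSmooth f) (hμ : IsStationaryStatisticalSolution ν f μ)
    (hcei : (∀ (m : ℕ) (g : Fin m → UnitAddTorus (Fin 3) → EuclideanSpace ℝ (Fin 3)),
      (∀ j, IsSmooth (g j)) → (∀ j, IsDivFree (g j)) → (∀ j, HasZeroMean (g j)) →
      ∀ ψ : EuclideanSpace ℝ (Fin m) × ℝ → ℝ, ContDiff ℝ 1 ψ →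
        (∃ C : ℝ, ∀ z, |ψ z| ≤ C ∧ ‖fderiv ℝ ψ z‖ ≤ C) →
        (∀ ξ : EuclideanSpace ℝ (Fin m), Monotone fun e : ℝ => ψ (ξ, e)) →
        Integrable (fun u : Torus.energySpace (Fin 3) =>
            fderiv ℝ ψ (WithLp.toLp 2 fun j => pairing u.1 (g j), ‖u‖ ^ 2) (0, 1) *
              (ν * (eGradNormSq (u.1 : UnitAddTorus (Fin 3) → EuclideanSpace ℝ (Fin 3))).toReal - pairing u.1 f)) μ ∧
        Integrable (fun u : Torus.energySpace (Fin 3) =>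
            nsGeneratorPairing ν f u (fun x => ∑ j, fderiv ℝ ψ (WithLp.toLp 2 fun j => pairing u.1 (g j), ‖u‖ ^ 2)
              (EuclideanSpace.single j 1, 0) • g j x)) μ ∧
        2 * ∫ u, fderiv ℝ ψ (WithLp.toLp 2 fun j => pairing u.1 (g j), ‖u‖ ^ 2) (0, 1) *
              (ν * (eGradNormSq (u.1 : UnitAddTorus (Fin 3) → EuclideanSpace ℝ (Fin 3))).toReal - pairing u.1 f) ∂μ ≤
          ∫ u, nsGeneratorPairing ν f u (fun x => ∑ j, fderiv ℝ ψ (WithLp.toLp 2 fun j => pairing u.1 (g j), ‖u‖ ^ 2)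
              (EuclideanSpace.single j 1, 0) • g j x) ∂μ))
    {R : ℝ} (hR : ∀ᵐ u ∂μ, ‖u‖ ≤ R)
    {D : ℕ} {g : Fin D → UnitAddTorus (Fin 3) → EuclideanSpace ℝ (Fin 3)}
    (hg : ∀ j, IsSmooth (g j)) (hgdiv : ∀ j, IsDivFree (g j)) (hg0 : ∀ j, HasZeroMean (g j))
    (hξ : ∀ u : Torus.energySpace (Fin 3), ∑ j, (pairing u.1 (g j)) ^ 2 ≤ ‖u‖ ^ 2)
    {L : (Fin 3 → ℤ) → ℝ}
    (hL : ∀ u : Torus.energySpace (Fin 3), ‖u‖ ≤ R → ∀ k,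
      ‖mFourierCoeff (EuclideanSpace.complexify ∘ fun x => ∑ j, nsGeneratorPairing ν f u (g j) • g j x) k‖ ≤ L k)
    {δ : ℝ} (hδ : 0 < δ) :
    ∃ (ρ₁ : EuclideanSpace ℝ (Fin D) → ℝ) (ρ₂ : ℝ → ℝ)
      (J : EuclideanSpace ℝ (Fin D) × ℝ → EuclideanSpace ℝ (Fin D) × ℝ) (p₁ : EuclideanSpace ℝ (Fin D) × ℝ → ℝ),
      (Continuous ρ₁ ∧ (∀ y, 0 ≤ ρ₁ y) ∧ (∀ y, δ ≤ ‖y‖ → ρ₁ y = 0) ∧ ∫ y, ρ₁ y = 1) ∧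
      (Continuous ρ₂ ∧ (∀ s, 0 ≤ ρ₂ s) ∧ (∀ s, s ∉ Ioo 0 δ → ρ₂ s = 0) ∧ ∫ s, ρ₂ s = 1) ∧
      ContDiff ℝ 1 J ∧ tsupport J ⊆ closedBall (0 : EuclideanSpace ℝ (Fin D)) (R + δ) ×ˢ Icc 0 (R ^ 2 + δ) ∧
      (∀ z, ∑ j, fderiv ℝ (fun z => (J z).1 j) z (EuclideanSpace.single j 1, 0) +
        fderiv ℝ (fun z => (J z).2) z (0, 1) = 0) ∧
      ContDiff ℝ 1 p₁ ∧ (∀ z, 0 ≤ p₁ z) ∧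
      (∀ z, z ∉ closedBall (0 : EuclideanSpace ℝ (Fin D)) (R + δ) ×ˢ Icc 0 (R ^ 2 + δ) → p₁ z = 0) ∧
      (∫ z, p₁ z ∂((volume : Measure (EuclideanSpace ℝ (Fin D))).prod (volume : Measure ℝ)) = 1) ∧
      (∀ z : EuclideanSpace ℝ (Fin D) × ℝ,
        p₁ z = ∫ u, ρ₁ (z.1 - WithLp.toLp 2 fun j => pairing u.1 (g j)) * ρ₂ (z.2 - ‖u‖ ^ 2) ∂μ) ∧
      (∀ z j, (J z).1 j = ∫ u, ρ₁ (z.1 - WithLp.toLp 2 fun j => pairing u.1 (g j)) * ρ₂ (z.2 - ‖u‖ ^ 2) *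
        nsGeneratorPairing ν f u (g j) ∂μ) ∧
      (∀ z : EuclideanSpace ℝ (Fin D) × ℝ, Integrable (fun u : Torus.energySpace (Fin 3) =>
        ρ₁ (z.1 - WithLp.toLp 2 fun j => pairing u.1 (g j)) * ρ₂ (z.2 - ‖u‖ ^ 2) *
          (ν * (eGradNormSq (u.1 : UnitAddTorus (Fin 3) → EuclideanSpace ℝ (Fin 3))).toReal - pairing u.1 f)) μ) ∧
      (∀ z, (J z).2 + 2 * ∫ u, ρ₁ (z.1 - WithLp.toLp 2 fun j => pairing u.1 (g j)) * ρ₂ (z.2 - ‖u‖ ^ 2) *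
          (ν * (eGradNormSq (u.1 : UnitAddTorus (Fin 3) → EuclideanSpace ℝ (Fin 3))).toReal - pairing u.1 f) ∂μ ≤ 0) ∧
      (∀ z k, ‖mFourierCoeff (EuclideanSpace.complexify ∘ fun x => ∑ j, (J z).1 j • g j x) k‖ ≤ L k * p₁ z) := by
  haveI := hμ.prob
  /- (A2) the kernels -/
  obtain ⟨ρ₁, ρ₂, P₂, hρ₁c, hρ₁0, hρ₁δ, hρ₁1, hρ₁cs, ⟨M₁, hM₁⟩, hρ₂c, -, hρ₂0, hρ₂δ, hρ₂1, hP₂d, hP₂0,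
    hP₂1, hP₂01, -, hprof⟩ := stub_augCurrentProfileTools D hδ
  have hρ₁c1 : ContDiff ℝ 1 ρ₁ := hρ₁c.of_le (by exact_mod_cast le_top)
  have hρ₂c1 : ContDiff ℝ 1 ρ₂ := hρ₂c.of_le (by exact_mod_cast le_top)
  have hM₁' : ∀ y, |ρ₁ y| ≤ M₁ ∧ ‖fderiv ℝ ρ₁ y‖ ≤ M₁ := fun y =>
    ⟨by rw [abs_of_nonneg (hρ₁0 y)]; exact (hM₁ y).1, (hM₁ y).2⟩
  have hρ₂cs : HasCompactSupport ρ₂ :=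
    HasCompactSupport.intro isCompact_Icc fun s hs => hρ₂δ s fun h => hs (Ioo_subset_Icc_self h)
  obtain ⟨M₂, hM₂⟩ := hρ₂cs.exists_bound_of_continuous hρ₂c.continuous
  have hM₂' : ∀ s, |ρ₂ s| ≤ M₂ := fun s => by have h := hM₂ s; rwa [Real.norm_eq_abs] at h
  have hρ₂d : ∀ s, HasDerivAt ρ₂ (deriv ρ₂ s) s := fun s => ((hρ₂c1.differentiable one_ne_zero) s).hasDerivAt
  obtain ⟨M₃, hM₃⟩ := hρ₂cs.deriv.exists_bound_of_continuous (hρ₂c1.continuous_deriv le_rfl)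
  have hM₃' : ∀ s, |deriv ρ₂ s| ≤ M₃ := fun s => by have h := hM₃ s; rwa [Real.norm_eq_abs] at h
  have hP₂b : ∀ s, |P₂ s| ≤ 1 := fun s => by rw [abs_of_nonneg (hP₂01 s).1]; exact (hP₂01 s).2
  -- `ρ₁` and `Dρ₁` vanish outside the `δ`-ball
  have htsupp : tsupport ρ₁ ⊆ closedBall (0 : EuclideanSpace ℝ (Fin D)) δ :=
    closure_minimal (fun y hy => mem_closedBall_zero_iff.2 (not_lt.1 fun h => hy (hρ₁δ y h.le))) isClosed_closedBall
  have hfar : ∀ y : EuclideanSpace ℝ (Fin D), δ < ‖y‖ → ρ₁ y = 0 ∧ fderiv ℝ ρ₁ y = 0 := fun y hy =>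
    ⟨hρ₁δ y hy.le, fderiv_of_notMem_tsupport ℝ fun h => not_le.2 hy (mem_closedBall_zero_iff.1 (htsupp h))⟩
  -- the partial derivatives `∂ⱼρ₁`: `C¹`, compactly supported, bounded with bounded derivative
  let dρ : Fin D → EuclideanSpace ℝ (Fin D) → ℝ := fun j y => fderiv ℝ ρ₁ y (EuclideanSpace.single j 1)
  have hdρc : ∀ j, ContDiff ℝ 1 (dρ j) := fun j =>
    (hρ₁c.fderiv_right (m := 1) (by exact WithTop.coe_le_coe.2 le_top)).clm_apply contDiff_const
  have hdρcs : ∀ j, HasCompactSupport (dρ j) := fun j => hρ₁cs.fderiv_apply (𝕜 := ℝ) (EuclideanSpace.single j 1)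
  have hA : ∀ j, ∃ A : ℝ, ∀ y, |dρ j y| ≤ A ∧ ‖fderiv ℝ (dρ j) y‖ ≤ A := fun j => by
    obtain ⟨A₁, hA₁⟩ := (hdρcs j).exists_bound_of_continuous (hdρc j).continuous
    obtain ⟨A₂, hA₂⟩ := ((hdρcs j).fderiv ℝ).exists_bound_of_continuous ((hdρc j).continuous_fderiv one_ne_zero)
    exact ⟨max A₁ A₂, fun y => ⟨(Real.norm_eq_abs _ ▸ hA₁ y).trans (le_max_left _ _), (hA₂ y).trans (le_max_right _ _)⟩⟩
  choose A hA using hA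
  /- the tensor kernels `κ = ρ₁ ⊗ ρ₂`, `κe j = ∂ⱼρ₁ ⊗ P₂` -/
  let κ : EuclideanSpace ℝ (Fin D) × ℝ → ℝ := fun y => ρ₁ y.1 * ρ₂ y.2
  let κe : Fin D → EuclideanSpace ℝ (Fin D) × ℝ → ℝ := fun j y => dρ j y.1 * P₂ y.2
  obtain ⟨hκc, hκK, hκv⟩ : ContDiff ℝ 1 κ ∧ (∀ y, |κ y| ≤ M₁ * M₂ + M₁ * M₃ ∧ ‖fderiv ℝ κ y‖ ≤ M₁ * M₂ + M₁ * M₃) ∧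
      ∀ (y : EuclideanSpace ℝ (Fin D) × ℝ) (v : EuclideanSpace ℝ (Fin D)) (s : ℝ),
        fderiv ℝ κ y (v, s) = fderiv ℝ ρ₁ y.1 v * ρ₂ y.2 + ρ₁ y.1 * (deriv ρ₂ y.2 * s) :=
    stub_augCurrentLevelEntryTools hρ₁c1 hρ₂d (hρ₂c1.continuous_deriv le_rfl) hM₁' hM₂' hM₃'
  have hκj : ∀ j, ContDiff ℝ 1 (κe j) ∧ (∀ y, |κe j y| ≤ A j * 1 + A j * M₂ ∧ ‖fderiv ℝ (κe j) y‖ ≤ A j * 1 + A j * M₂) ∧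
      ∀ (y : EuclideanSpace ℝ (Fin D) × ℝ) (v : EuclideanSpace ℝ (Fin D)) (s : ℝ),
        fderiv ℝ (κe j) y (v, s) = fderiv ℝ (dρ j) y.1 v * P₂ y.2 + dρ j y.1 * (ρ₂ y.2 * s) := fun j =>
    stub_augCurrentLevelEntryTools (hdρc j) hP₂d hρ₂c.continuous (hA j) hP₂b hM₂'
  have hκ0 : ∀ y, 0 ≤ κ y := fun y => mul_nonneg (hρ₁0 _) (hρ₂0 _)
  have hκcs : HasCompactSupport κ := by
    refine HasCompactSupport.intro (K := tsupport ρ₁ ×ˢ Icc 0 δ) (hρ₁cs.prod isCompact_Icc) fun y hy => ?_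
    rcases not_and_or.1 (fun h => hy (Set.mem_prod.2 h)) with h | h
    · show ρ₁ y.1 * ρ₂ y.2 = 0
      rw [image_eq_zero_of_notMem_tsupport h, zero_mul]
    · show ρ₁ y.1 * ρ₂ y.2 = 0
      rw [hρ₂δ _ fun h' => h (Ioo_subset_Icc_self h'), mul_zero]
  /- coordinates and weights -/
  let Z : Torus.energySpace (Fin 3) → EuclideanSpace ℝ (Fin D) × ℝ :=
    fun u => (WithLp.toLp 2 fun j => pairing u.1 (g j), ‖u‖ ^ 2)
  have hZc : Continuous Z :=
    ((PiLp.continuous_toLp 2 _).comp (continuous_pi fun j => continuous_pairing_coe ((hg j).memLp 2))).prodMk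
      (continuous_norm.pow 2)
  have hZm : Measurable Z := hZc.measurable
  have hZ1 : ∀ u, ‖(Z u).1‖ ≤ ‖u‖ := fun u => by
    have h : ‖(Z u).1‖ ^ 2 ≤ ‖u‖ ^ 2 := by
      rw [EuclideanSpace.norm_sq_eq]
      simpa only [Real.norm_eq_abs, sq_abs] using hξ u
    exact le_of_pow_le_pow_left₀ two_ne_zero (norm_nonneg _) h
  let F : Fin D → Torus.energySpace (Fin 3) → ℝ := fun j u => nsGeneratorPairing ν f u (g j)
  have hFc : ∀ j, Continuous (F j) := fun j => continuous_nsGeneratorPairing ν f (hg j)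
  have hFK := fun j => exists_abs_nsGeneratorPairing_le ν f (hg j)
  choose K hK0 hK using hFK
  have hFM : ∀ j, ∀ᵐ u ∂μ, |F j u| ≤ K j * (1 + R ^ 2) := fun j => hR.mono fun u hu => by
    have h2 : ‖u‖ ^ 2 ≤ R ^ 2 := pow_le_pow_left₀ (norm_nonneg _) hu 2
    exact (hK j u).trans (mul_le_mul_of_nonneg_left (by linarith) (hK0 j))
  -- integrability of (kernel ∘ shift) × weight, and of kernel ∘ shift
  have hint : ∀ {θ : EuclideanSpace ℝ (Fin D) × ℝ → ℝ}, Continuous θ → ∀ {C : ℝ}, (∀ y, |θ y| ≤ C) →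
      ∀ j z, Integrable (fun u => θ (z - Z u) * F j u) μ := fun {θ} hθ {C} hC j z =>
    Integrable.of_bound (((hθ.comp (continuous_const.sub hZc)).aestronglyMeasurable).mul
      (hFc j).aestronglyMeasurable) (C := C * (K j * (1 + R ^ 2))) ((hFM j).mono fun u hu => by
        rw [Real.norm_eq_abs, abs_mul]
        exact mul_le_mul (hC _) hu (abs_nonneg _) ((abs_nonneg (θ (z - Z u))).trans (hC (z - Z u))))
  have hintκ : ∀ z, Integrable (fun u => κ (z - Z u)) μ := fun z =>
    Integrable.of_bound ((hκc.continuous.comp (continuous_const.sub hZc)).aestronglyMeasurable)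
      (C := M₁ * M₂ + M₁ * M₃) (Eventually.of_forall fun u => by rw [Real.norm_eq_abs]; exact (hκK _).1)
  /- the entries -/
  let Jw : Fin D → EuclideanSpace ℝ (Fin D) × ℝ → ℝ := fun j z => ∫ u, κ (z - Z u) * F j u ∂μ
  let Je : Fin D → EuclideanSpace ℝ (Fin D) × ℝ → ℝ := fun j z => ∫ u, κe j (z - Z u) * F j u ∂μ
  let p₁ : EuclideanSpace ℝ (Fin D) × ℝ → ℝ := fun z => ∫ u, κ (z - Z u) ∂μ
  let J : EuclideanSpace ℝ (Fin D) × ℝ → EuclideanSpace ℝ (Fin D) × ℝ :=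
    fun z => (WithLp.toLp 2 fun j => Jw j z, -∑ j, Je j z)
  have hKw : ∀ j, (∀ z, HasFDerivAt (Jw j) (∫ u, F j u • fderiv ℝ κ (z - Z u) ∂μ) z) ∧ ContDiff ℝ 1 (Jw j) :=
    fun j => by
    obtain ⟨h1, -, h3⟩ := stub_augCurrentKernelTools μ hZm (hFc j).aestronglyMeasurable (hFM j) hκc hκK
    exact ⟨h1, h3⟩
  have hKe : ∀ j, (∀ z, HasFDerivAt (Je j) (∫ u, F j u • fderiv ℝ (κe j) (z - Z u) ∂μ) z) ∧ ContDiff ℝ 1 (Je j) :=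
    fun j => by
    obtain ⟨h1, -, h3⟩ := stub_augCurrentKernelTools μ hZm (hFc j).aestronglyMeasurable (hFM j) (hκj j).1 (hκj j).2.1
    exact ⟨h1, h3⟩
  have hKp : ContDiff ℝ 1 p₁ := by
    obtain ⟨-, -, h3⟩ := stub_augCurrentKernelTools μ hZm (F := fun _ => (1 : ℝ)) aestronglyMeasurable_const
      (M := 1) (Eventually.of_forall fun _ => by simp) hκc hκK
    simpa only [mul_one] using h3
  /- `C¹` regularity and the classical divergence -/
  have hJ1 : ContDiff ℝ 1 (fun z => (WithLp.toLp 2 fun j => Jw j z : EuclideanSpace ℝ (Fin D))) :=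
    contDiff_piLp' 2 fun j => (hKw j).2
  have hJc1 : ContDiff ℝ 1 J := hJ1.prodMk (ContDiff.neg (ContDiff.sum fun j _ => (hKe j).2))
  have hdiv : ∀ z, ∑ j, fderiv ℝ (fun z => (J z).1 j) z (EuclideanSpace.single j 1, 0) +
      fderiv ℝ (fun z => (J z).2) z (0, 1) = 0 := fun z => by
    have e1 : ∀ j, fderiv ℝ (fun z => (J z).1 j) z (EuclideanSpace.single j 1, 0) =
        ∫ u, F j u * fderiv ℝ κ (z - Z u) (EuclideanSpace.single j 1, 0) ∂μ := fun j =>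
      (fderiv_entry_apply μ hZm (hFc j).aestronglyMeasurable (hFM j) hκc hκK z _).2
    have e2 : fderiv ℝ (fun z => (J z).2) z (0, 1) = -∑ j, ∫ u, F j u * fderiv ℝ (κe j) (z - Z u) (0, 1) ∂μ := by
      have hs : HasFDerivAt (fun z => ∑ j, Je j z) (∑ j, ∫ u, F j u • fderiv ℝ (κe j) (z - Z u) ∂μ) z :=
        HasFDerivAt.fun_sum fun j _ => (hKe j).1 z
      rw [show (fun z => (J z).2) = fun z => -∑ j, Je j z from rfl, hs.fun_neg.fderiv]
      simp only [neg_apply, FunLike.coe_sum, Finset.sum_apply, neg_inj]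
      exact Finset.sum_congr rfl fun j _ =>
        (fderiv_entry_apply μ hZm (hFc j).aestronglyMeasurable (hFM j) (hκj j).1 (hκj j).2.1 z _).1
    rw [Finset.sum_congr rfl fun j _ => e1 j, e2, ← Finset.sum_neg_distrib, ← Finset.sum_add_distrib]
    refine Finset.sum_eq_zero fun j _ => ?_
    have : (fun u => F j u * fderiv ℝ κ (z - Z u) (EuclideanSpace.single j 1, 0)) =
        fun u => F j u * fderiv ℝ (κe j) (z - Z u) (0, 1) := funext fun u => by
      rw [hκv, (hκj j).2.2]
      simp only [map_zero, mul_zero, add_zero, zero_mul, zero_add, mul_one]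
      rfl
    rw [this, add_neg_cancel]
  /- `CEI(ψ_z)` for the profile of `stub_augCurrentProfileTools` -/
  have hCEI : ∀ z : EuclideanSpace ℝ (Fin D) × ℝ,
      Integrable (fun u : Torus.energySpace (Fin 3) =>
        ρ₁ (z.1 - WithLp.toLp 2 fun j => pairing u.1 (g j)) * ρ₂ (z.2 - ‖u‖ ^ 2) *
          (ν * (eGradNormSq (u.1 : UnitAddTorus (Fin 3) → EuclideanSpace ℝ (Fin 3))).toReal - pairing u.1 f)) μ ∧
      2 * ∫ u, ρ₁ (z.1 - WithLp.toLp 2 fun j => pairing u.1 (g j)) * ρ₂ (z.2 - ‖u‖ ^ 2) *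
          (ν * (eGradNormSq (u.1 : UnitAddTorus (Fin 3) → EuclideanSpace ℝ (Fin 3))).toReal - pairing u.1 f) ∂μ ≤
        ∫ u, nsGeneratorPairing ν f u (fun x => ∑ j,
          (fderiv ℝ ρ₁ (z.1 - WithLp.toLp 2 fun j => pairing u.1 (g j)) (EuclideanSpace.single j 1) *
            P₂ (z.2 - ‖u‖ ^ 2)) • g j x) ∂μ := fun z => by
    obtain ⟨hψc, hψC, hψm, hψe, hψv⟩ := hprof z
    have H := hcei D g hg hgdiv hg0 _ hψc hψC hψm
    simp only [hψe, hψv] at H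
    exact ⟨H.1, H.2.2⟩
  -- linearity of the tested generator: `∫ ⟨F(u), Σⱼ cⱼ(u) gⱼ⟩ dμ = Σⱼ ∫ cⱼ(u) Fⱼ(u) dμ`
  have hsum : ∀ c : Fin D → Torus.energySpace (Fin 3) → ℝ, (∀ j, Integrable (fun u => c j u * F j u) μ) →
      ∫ u, nsGeneratorPairing ν f u (fun x => ∑ j, c j u • g j x) ∂μ = ∑ j, ∫ u, c j u * F j u ∂μ := fun c hc => by
    rw [← integral_finsetSum _ fun j _ => hc j]
    exact integral_congr_ae (Eventually.of_forall fun u =>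
      nsGeneratorPairing_sum_smul ν hf.integrable u Finset.univ (fun j => c j u) fun j _ => hg j)
  have hJe_le : ∀ z, (J z).2 + 2 * ∫ u, ρ₁ (z.1 - WithLp.toLp 2 fun j => pairing u.1 (g j)) * ρ₂ (z.2 - ‖u‖ ^ 2) *
      (ν * (eGradNormSq (u.1 : UnitAddTorus (Fin 3) → EuclideanSpace ℝ (Fin 3))).toReal - pairing u.1 f) ∂μ ≤ 0 :=
    fun z => by
    have h := ((hCEI z).2).trans_eq (hsum (fun j u => κe j (z - Z u)) fun j =>
      hint (hκj j).1.continuous (fun y => ((hκj j).2.1 y).1) j z)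
    show -(∑ j, Je j z) + _ ≤ 0
    linarith
  /- support: the kernels vanish a.e. off the box -/
  have hout : ∀ z : EuclideanSpace ℝ (Fin D) × ℝ,
      z ∉ closedBall (0 : EuclideanSpace ℝ (Fin D)) (R + δ) ×ˢ Icc 0 (R ^ 2 + δ) →
      R + δ < ‖z.1‖ ∨ z.2 < 0 ∨ R ^ 2 + δ < z.2 := fun z hz => by
    by_contra h
    simp only [not_or, not_lt] at h
    exact hz (Set.mem_prod.2 ⟨mem_closedBall_zero_iff.2 h.1, h.2.1, h.2.2⟩)
  have hκae : ∀ z : EuclideanSpace ℝ (Fin D) × ℝ, (R + δ < ‖z.1‖ ∨ z.2 < 0 ∨ R ^ 2 + δ < z.2) →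
      ∀ᵐ u ∂μ, κ (z - Z u) = 0 := fun z hz => hR.mono fun u hu => by
    have e2 : (z - Z u).2 = z.2 - ‖u‖ ^ 2 := rfl
    have hu2 : ‖u‖ ^ 2 ≤ R ^ 2 := pow_le_pow_left₀ (norm_nonneg _) hu 2
    show ρ₁ (z - Z u).1 * ρ₂ (z - Z u).2 = 0
    rcases hz with h | h | h
    · have h1 : δ < ‖(z - Z u).1‖ := by
        have := norm_sub_norm_le z.1 (Z u).1
        have h2 := (hZ1 u).trans hu
        rw [Prod.fst_sub]; linarith
      rw [(hfar _ h1).1, zero_mul]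
    · rw [hρ₂δ _ fun h' => ?_, mul_zero]
      rw [e2] at h'; nlinarith [h'.1, sq_nonneg ‖u‖]
    · rw [hρ₂δ _ fun h' => ?_, mul_zero]
      rw [e2] at h'; linarith [h'.2]
  have hκeae : ∀ z : EuclideanSpace ℝ (Fin D) × ℝ, (R + δ < ‖z.1‖ ∨ z.2 < 0) → ∀ j,
      ∀ᵐ u ∂μ, κe j (z - Z u) = 0 := fun z hz j => hR.mono fun u hu => by
    show fderiv ℝ ρ₁ (z - Z u).1 (EuclideanSpace.single j 1) * P₂ (z - Z u).2 = 0
    rcases hz with h | h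
    · have h1 : δ < ‖(z - Z u).1‖ := by
        have := norm_sub_norm_le z.1 (Z u).1
        have h2 := (hZ1 u).trans hu
        rw [Prod.fst_sub]; linarith
      rw [(hfar _ h1).2, zero_apply, zero_mul]
    · rw [hP₂0 _ ?_, mul_zero]
      show z.2 - ‖u‖ ^ 2 ≤ 0; nlinarith [sq_nonneg ‖u‖]
  have hκeae' : ∀ z : EuclideanSpace ℝ (Fin D) × ℝ, R ^ 2 + δ < z.2 → ∀ j,
      ∀ᵐ u ∂μ, κe j (z - Z u) = dρ j (z - Z u).1 := fun z hz j => hR.mono fun u hu => by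
    have hu2 : ‖u‖ ^ 2 ≤ R ^ 2 := pow_le_pow_left₀ (norm_nonneg _) hu 2
    show dρ j (z - Z u).1 * P₂ (z - Z u).2 = _
    rw [hP₂1 _ ?_, mul_one]
    show δ ≤ z.2 - ‖u‖ ^ 2; linarith
  -- vanishing of the entries off the box
  have hJw0 : ∀ z j, (R + δ < ‖z.1‖ ∨ z.2 < 0 ∨ R ^ 2 + δ < z.2) → Jw j z = 0 := fun z j hz =>
    integral_eq_zero_of_ae ((hκae z hz).mono fun u hu => by simp only [hu, zero_mul, Pi.zero_apply])
  have hp10 : ∀ z, (R + δ < ‖z.1‖ ∨ z.2 < 0 ∨ R ^ 2 + δ < z.2) → p₁ z = 0 := fun z hz =>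
    integral_eq_zero_of_ae ((hκae z hz).mono fun u hu => by simp only [hu, Pi.zero_apply])
  have hJe0 : ∀ z, (R + δ < ‖z.1‖ ∨ z.2 < 0 ∨ R ^ 2 + δ < z.2) → ∑ j, Je j z = 0 := fun z hz => by
    rcases hz with h | h | h
    · exact Finset.sum_eq_zero fun j _ => integral_eq_zero_of_ae ((hκeae z (Or.inl h) j).mono fun u hu => by
        simp only [hu, zero_mul, Pi.zero_apply])
    · exact Finset.sum_eq_zero fun j _ => integral_eq_zero_of_ae ((hκeae z (Or.inr h) j).mono fun u hu => by
        simp only [hu, zero_mul, Pi.zero_apply])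
    · -- above the energy range: `Σⱼ Je j z = Σⱼ ∫ ∂ⱼρ₁(w − ξ(u)) Fⱼ(u) dμ`, zero by `CEI(ψ_z)` and `CEI(+ρ₁(w − ·))`
      have hrepr : ∀ j, Je j z = ∫ u, dρ j (z - Z u).1 * F j u ∂μ := fun j =>
        integral_congr_ae ((hκeae' z h j).mono fun u hu => by simp only [hu])
      have hintd : ∀ j, Integrable (fun u => dρ j (z - Z u).1 * F j u) μ := fun j =>
        hint (θ := fun y => dρ j y.1) ((hdρc j).continuous.comp continuous_fst) (fun y => ((hA j) y.1).1) j z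
      have hlow : 0 ≤ ∑ j, Je j z := by
        have h1 := ((hCEI z).2).trans_eq (hsum (fun j u => κe j (z - Z u)) fun j =>
          hint (hκj j).1.continuous (fun y => ((hκj j).2.1 y).1) j z)
        have h0 : ∫ u, ρ₁ (z.1 - WithLp.toLp 2 fun j => pairing u.1 (g j)) * ρ₂ (z.2 - ‖u‖ ^ 2) *
            (ν * (eGradNormSq (u.1 : UnitAddTorus (Fin 3) → EuclideanSpace ℝ (Fin 3))).toReal - pairing u.1 f) ∂μ = 0 :=
          integral_eq_zero_of_ae ((hκae z (Or.inr (Or.inr h))).mono fun u hu => by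
            have hu' : ρ₁ (z.1 - WithLp.toLp 2 fun j => pairing u.1 (g j)) * ρ₂ (z.2 - ‖u‖ ^ 2) = 0 := hu
            simp only [hu', zero_mul, Pi.zero_apply])
        rw [h0, mul_zero] at h1
        exact h1
      have hup : ∑ j, Je j z ≤ 0 := by
        obtain ⟨hc, hb, he, hv⟩ := reflectedProfile_facts hρ₁c1 hM₁' z.1
        obtain ⟨-, -, h1⟩ := hcei D g hg hgdiv hg0 _ hc ⟨M₁, hb⟩ (fun ξ _ _ _ => le_of_eq rfl)
        simp only [he, hv, zero_mul, integral_zero, mul_zero] at h1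
        have h2 := h1.trans_eq (hsum (fun j u => -dρ j (z - Z u).1) fun j => (hintd j).neg.congr
          (Eventually.of_forall fun u => (neg_mul _ _).symm))
        have h3 : ∑ j, ∫ u, -dρ j (z - Z u).1 * F j u ∂μ = -∑ j, Je j z := by
          rw [← Finset.sum_neg_distrib]
          refine Finset.sum_congr rfl fun j _ => ?_
          rw [hrepr j, ← integral_neg]
          exact integral_congr_ae (Eventually.of_forall fun u => neg_mul _ _)
        linarith
      linarith
  /- mass of the mollified law -/
  have hmass : ∫ z, p₁ z ∂((volume : Measure (EuclideanSpace ℝ (Fin D))).prod (volume : Measure ℝ)) = 1 := by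
    have hκi : Integrable κ ((volume : Measure (EuclideanSpace ℝ (Fin D))).prod (volume : Measure ℝ)) :=
      hκc.continuous.integrable_of_hasCompactSupport hκcs
    rw [integral_integral_kernel_sub μ _ hZm hκc.continuous hκi]
    show ∫ y, ρ₁ y.1 * ρ₂ y.2 ∂((volume : Measure (EuclideanSpace ℝ (Fin D))).prod (volume : Measure ℝ)) = 1
    rw [integral_prod_mul, hρ₁1, hρ₂1, one_mul]
  /- the rate bound -/
  have hrate : ∀ z k, ‖mFourierCoeff (EuclideanSpace.complexify ∘ fun x => ∑ j, (J z).1 j • g j x) k‖ ≤ L k * p₁ z :=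
    fun z k => by
    have hI : ∀ j, Integrable (fun u => κ (z - Z u) * F j u) μ := fun j => hint hκc.continuous (fun y => (hκK y).1) j z
    have h1 : ∑ j, Jw j z • mFourierCoeff (EuclideanSpace.complexify ∘ g j) k =
        ∫ u, κ (z - Z u) • ∑ j, F j u • mFourierCoeff (EuclideanSpace.complexify ∘ g j) k ∂μ := by
      simp_rw [Finset.smul_sum, smul_smul]
      rw [integral_finsetSum _ fun j _ => (hI j).smul_const _]
      exact Finset.sum_congr rfl fun j _ => (integral_smul_const _ _).symm
    have hb : ∀ᵐ u ∂μ, ‖κ (z - Z u) • ∑ j, F j u • mFourierCoeff (EuclideanSpace.complexify ∘ g j) k‖ ≤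
        κ (z - Z u) * L k := hR.mono fun u hu => by
      rw [norm_smul, Real.norm_eq_abs, abs_of_nonneg (hκ0 _), ← mFourierCoeff_sum_smul_marg hg (fun j => F j u) k]
      exact mul_le_mul_of_nonneg_left (hL u hu k) (hκ0 _)
    show ‖mFourierCoeff (EuclideanSpace.complexify ∘ fun x => ∑ j, Jw j z • g j x) k‖ ≤ L k * p₁ z
    rw [mFourierCoeff_sum_smul_marg hg (fun j => Jw j z) k, h1]
    calc ‖∫ u, κ (z - Z u) • ∑ j, F j u • mFourierCoeff (EuclideanSpace.complexify ∘ g j) k ∂μ‖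
        ≤ ∫ u, κ (z - Z u) * L k ∂μ := norm_integral_le_of_norm_le ((hintκ z).mul_const _) hb
      _ = L k * p₁ z := by rw [integral_mul_const, mul_comm]
  /- packaging -/
  refine ⟨ρ₁, ρ₂, J, p₁, ⟨hρ₁c.continuous, hρ₁0, hρ₁δ, hρ₁1⟩, ⟨hρ₂c.continuous, hρ₂0, hρ₂δ, hρ₂1⟩, hJc1, ?_, hdiv,
    hKp, fun z => integral_nonneg fun u => hκ0 _, fun z hz => hp10 z (hout z hz), hmass, fun z => rfl,
    fun z j => rfl, fun z => (hCEI z).1, hJe_le, hrate⟩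
  -- `tsupport J ⊆ box`
  refine closure_minimal (fun z hz => ?_) ((isCompact_closedBall _ _).prod isCompact_Icc).isClosed
  by_contra hzB
  refine hz (Prod.ext (PiLp.ext fun j => ?_) ?_)
  · show Jw j z = 0
    exact hJw0 z j (hout z hzB)
  · show -∑ j, Je j z = 0
    rw [hJe0 z (hout z hzB), neg_zero]

end Summit.AnomalousDissipation.AnomalousDissipation.Theorems.EnsembleRealization
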